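import Summits.Ventures.CertifiedArithmetic.LowPrec.OptTreeSequential
import Summits.Ventures.CertifiedArithmetic.LowPrec.OptTreeWitness

/-!
# OptRegisters — Theorem T6(d): the register–height law for streaming summation trees (cost model CM-T)

HONEST FRAMING: certified error envelopes and provably optimal rounding/accumulation schemes for
low-precision formats under stated cost models; every table by two implementations; no hardware or
vendor claims.

Cost model CM-T (bounded temporaries): the summands arrive as a stream and are combined by a binary
summation tree whose leaves, read left to right, are the stream; a node `l + r` is evaluated by first
evaluating `l`, holding its value in a register while `r` is evaluated, then adding.  The number of
registers this needs is `regs` (`regs leaf = 0`, `regs (node l r) = max (regs l) (regs r + 1)`): recursive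
summation needs 1, blocked (two-level) summation 2, pairwise summation of `n` summands `⌈log₂ n⌉`.
The tree's HEIGHT `C` controls its worst-case rounding error: the exact worst-case relative
under-estimation is `1 - 1/M_t(u)` (Theorem U, `OptTreeWitness`) and `1 + C·u ≤ M_t(u) ≤ (1+u)^C`
(`one_add_height_mul_le_treeM`, `treeM_le_pow_height`; `height` from `OptTreeWitness`), i.e. `C·u` to first order.

* `length_leaves_le_Nreg` — the LAW: a tree of height `C` evaluable with `k` registers has at most
  `N_k(C) = Σ_{i ≤ k} binom(C, i)` leaves (`Nreg`; Pascal rule `Nreg_succ_succ`).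
* `length_leaves_bt`, `regs_bt_le`, `height_bt_le` — SHARPNESS: the binomial staircase tree `bt k C`
  has exactly `N_k(C)` leaves within the budgets; `exists_tree_of_le_Nreg` — every `n ≤ N_k(C)` is
  realisable.  Hence the least height of a `k`-register tree on `n` summands is
  `C*_k(n) = min {C : N_k(C) ≥ n}` and (`treeM_lower_bound_of_regs`) every such tree has
  `M ≥ 1 + C*_k(n)·u`.
* `two_mul_Nreg_two` — `k = 2`: `N_2(C) = C(C+1)/2 + 1`, so `C*_2(n) ≈ √(2n)`: the optimal two-register
  scheme is a STAIRCASE of blocks of increasing lengths `(2, 2, 3, 4, …, C)` — versus height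
  `b + m - 2 ≥ 2√n - 2` for `m` equal blocks of length `b` (`height_streamTree_replicate`), a first-order
  gain → `1/√2`.  `example_n64`: `n = 64`: `C*_2 = 11` while 8 blocks of 8 have height 14.
* `R4_RegisterHeightLaw` (+ `_holds`) — Statement-style summary.
-/

namespace Summit.Ventures.CertifiedArithmetic.LowPrec.Opt

open Literature.ComputerArithmetic.JeannerodRump2018
open Literature.ComputerArithmetic.JeannerodRump2018.SumTree

/-! ## Height, registers, and the binomial partial sums -/

/-- Registers needed to evaluate the tree on a left-to-right stream of its leaves (left operand first). -/
def regs : SumTree → ℕ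
  | .leaf _ => 0
  | .node l r => max (regs l) (regs r + 1)

/-- `N_k(C) = Σ_{i=0}^{k} binom(C, i)`: the most leaves a `k`-register tree of height `C` can have. -/
def Nreg (k C : ℕ) : ℕ := ∑ i ∈ Finset.range (k + 1), C.choose i

/-- `N_0(C) = 1`. -/
@[simp] theorem Nreg_zero_left (C : ℕ) : Nreg 0 C = 1 := by simp [Nreg]

/-- `N_k(0) = 1`. -/
@[simp] theorem Nreg_zero_right (k : ℕ) : Nreg k 0 = 1 := by
  unfold Nreg; rw [Finset.sum_range_succ']; simp

/-- PASCAL RULE: `N_{k+1}(C+1) = N_{k+1}(C) + N_k(C)`. -/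
theorem Nreg_succ_succ (k C : ℕ) : Nreg (k + 1) (C + 1) = Nreg (k + 1) C + Nreg k C := by
  unfold Nreg
  rw [Finset.sum_range_succ' (fun i => (C + 1).choose i), Finset.sum_range_succ' (fun i => C.choose i) (k + 1)]
  simp only [Nat.choose_succ_succ, Finset.sum_add_distrib, Nat.choose_zero_right]
  ring

/-- `N_k(C)` is monotone in `C`. -/
theorem Nreg_mono_right (k : ℕ) {C C' : ℕ} (h : C ≤ C') : Nreg k C ≤ Nreg k C' :=
  Finset.sum_le_sum fun i _ => Nat.choose_le_choose i h

/-- `N_k(C)` is monotone in `k`. -/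
theorem Nreg_mono_left {k k' : ℕ} (h : k ≤ k') (C : ℕ) : Nreg k C ≤ Nreg k' C :=
  Finset.sum_le_sum_of_subset (Finset.range_mono (by omega))

/-- `1 ≤ N_k(C)`. -/
theorem one_le_Nreg (k C : ℕ) : 1 ≤ Nreg k C :=
  le_trans (by simp) (Nreg_mono_left (Nat.zero_le k) C)

/-- `N_1(C) = C + 1` (recursive summation: one register, height = n - 1). -/
theorem Nreg_one (C : ℕ) : Nreg 1 C = C + 1 := by
  induction C with
  | zero => simp
  | succ C ih => rw [Nreg_succ_succ, ih, Nreg_zero_left]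

/-- `k = 2`: `2·N_2(C) = C(C+1) + 2`. -/
theorem two_mul_Nreg_two (C : ℕ) : 2 * Nreg 2 C = C * (C + 1) + 2 := by
  induction C with
  | zero => simp
  | succ C ih => rw [Nreg_succ_succ, Nreg_one, mul_add, ih]; ring

/-! ## The law and its sharpness -/

/-- THE REGISTER–HEIGHT LAW: `#leaves ≤ N_{regs}(height)`. -/
theorem length_leaves_le_Nreg : ∀ t : SumTree, (leaves t).length ≤ Nreg (regs t) (height t)
  | .leaf _ => by simp [leaves, regs]
  | .node l r => by
      have hl := length_leaves_le_Nreg l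
      have hr := length_leaves_le_Nreg r
      simp only [leaves, List.length_append, regs, height_node]
      obtain ⟨k', hk'⟩ := Nat.exists_eq_succ_of_ne_zero
        (show max (regs l) (regs r + 1) ≠ 0 by have := le_max_right (regs l) (regs r + 1); omega)
      rw [hk', Nreg_succ_succ]
      have e1 := le_max_left (regs l) (regs r + 1)
      have e2 := le_max_right (regs l) (regs r + 1)
      have h1 : Nreg (regs l) (height l) ≤ Nreg (k' + 1) (max (height l) (height r)) :=
        le_trans (Nreg_mono_left (by omega) _) (Nreg_mono_right _ (le_max_left _ _))
      have h2 : Nreg (regs r) (height r) ≤ Nreg k' (max (height l) (height r)) :=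
        le_trans (Nreg_mono_left (by omega) _) (Nreg_mono_right _ (le_max_right _ _))
      omega

/-- Contrapositive form: a `k`-register tree with more than `N_k(C)` leaves has height `> C`. -/
theorem height_lower_bound {t : SumTree} {k C : ℕ} (hk : regs t ≤ k) (hn : Nreg k C < (leaves t).length) :
    C + 1 ≤ height t := by
  by_contra h
  have h1 := length_leaves_le_Nreg t
  have h2 := Nreg_mono_left hk (height t)
  have h3 := Nreg_mono_right k (show height t ≤ C by omega)
  omega

/-- The binomial STAIRCASE tree `bt k C = node (bt k (C-1)) (bt (k-1) (C-1))`. -/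
def bt : ℕ → ℕ → SumTree
  | 0, _ => .leaf 0
  | _ + 1, 0 => .leaf 0
  | k + 1, C + 1 => .node (bt (k + 1) C) (bt k C)

/-- `bt k C` has exactly `N_k(C)` leaves. -/
theorem length_leaves_bt : ∀ k C : ℕ, (leaves (bt k C)).length = Nreg k C
  | 0, C => by simp [bt, leaves]
  | k + 1, 0 => by simp [bt, leaves]
  | k + 1, C + 1 => by
      simp only [bt, leaves, List.length_append, length_leaves_bt (k + 1) C, length_leaves_bt k C,
        Nreg_succ_succ]

/-- `bt k C` needs at most `k` registers. -/
theorem regs_bt_le : ∀ k C : ℕ, regs (bt k C) ≤ k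
  | 0, C => by simp [bt, regs]
  | k + 1, 0 => by simp [bt, regs]
  | k + 1, C + 1 => by
      simp only [bt, regs]
      exact max_le (regs_bt_le (k + 1) C) (by have := regs_bt_le k C; omega)

/-- `bt k C` has height at most `C`. -/
theorem height_bt_le : ∀ k C : ℕ, height (bt k C) ≤ C
  | 0, C => by simp [bt]
  | k + 1, 0 => by simp [bt]
  | k + 1, C + 1 => by
      simp only [bt, height_node]
      exact Nat.succ_le_succ (max_le (height_bt_le (k + 1) C) (height_bt_le k C))

/-- Every `1 ≤ n ≤ N_k(C)` is the leaf count of some tree within both budgets. -/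
theorem exists_tree_of_le_Nreg : ∀ (k C n : ℕ), 1 ≤ n → n ≤ Nreg k C →
    ∃ t : SumTree, (leaves t).length = n ∧ regs t ≤ k ∧ height t ≤ C
  | 0, C, n, h1, hn => ⟨.leaf 0, by simp [leaves] at hn ⊢; omega, by simp [regs], by simp⟩
  | k + 1, 0, n, h1, hn => ⟨.leaf 0, by simp [leaves] at hn ⊢; omega, by simp [regs], by simp⟩
  | k + 1, C + 1, n, h1, hn => by
      by_cases h : n ≤ Nreg (k + 1) C
      · obtain ⟨t, ht, hr, hh⟩ := exists_tree_of_le_Nreg (k + 1) C n h1 h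
        exact ⟨t, ht, hr, by omega⟩
      · rw [Nreg_succ_succ] at hn
        obtain ⟨t₁, h₁, r₁, hh₁⟩ := exists_tree_of_le_Nreg (k + 1) C (Nreg (k + 1) C) (one_le_Nreg _ _) le_rfl
        obtain ⟨t₂, h₂, r₂, hh₂⟩ := exists_tree_of_le_Nreg k C (n - Nreg (k + 1) C) (by omega) (by omega)
        refine ⟨.node t₁ t₂, ?_, ?_, ?_⟩
        · simp only [leaves, List.length_append, h₁, h₂]; omega
        · simp only [regs]; exact max_le r₁ (by omega)
        · simp only [height_node]; exact Nat.succ_le_succ (max_le hh₁ hh₂)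

/-! ## Height controls the tree polynomial -/

/-- `1 + height·u ≤ M_t(u)` (`u ≥ 0`). -/
theorem one_add_height_mul_le_treeM {u : ℚ} (hu : 0 ≤ u) : ∀ t : SumTree, 1 + (height t : ℚ) * u ≤ treeM u t
  | .leaf _ => by simp
  | .node l r => by
      have hl := one_add_height_mul_le_treeM hu l
      have hr := one_add_height_mul_le_treeM hu r
      have h1 := one_le_treeM hu l
      have h2 := one_le_treeM hu r
      rw [treeM_node]; simp only [height_node]; push_cast
      have hmin : u * 1 ≤ u * min (treeM u l) (treeM u r) := mul_le_mul_of_nonneg_left (le_min h1 h2) hu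
      have hM1 := le_max_left (treeM u l) (treeM u r)
      have hM2 := le_max_right (treeM u l) (treeM u r)
      rcases le_total (height l) (height r) with h | h
      · rw [max_eq_right (show (height l : ℚ) ≤ height r by exact_mod_cast h)]; nlinarith
      · rw [max_eq_left (show (height r : ℚ) ≤ height l by exact_mod_cast h)]; nlinarith

/-- `M_t(u) ≤ (1+u)^height` (`u ≥ 0`). -/
theorem treeM_le_pow_height {u : ℚ} (hu : 0 ≤ u) : ∀ t : SumTree, treeM u t ≤ (1 + u) ^ height t
  | .leaf _ => by simp
  | .node l r => by
      have hl := treeM_le_pow_height hu l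
      have hr := treeM_le_pow_height hu r
      rw [treeM_node]; simp only [height_node, pow_succ]
      have hmax : max (treeM u l) (treeM u r) ≤ (1 + u) ^ max (height l) (height r) :=
        max_le (le_trans hl (pow_le_pow_right₀ (by linarith) (le_max_left _ _)))
          (le_trans hr (pow_le_pow_right₀ (by linarith) (le_max_right _ _)))
      have hmin : min (treeM u l) (treeM u r) ≤ max (treeM u l) (treeM u r) := min_le_max
      nlinarith [mul_le_mul_of_nonneg_left hmin hu, mul_le_mul_of_nonneg_left hmax hu]

/-- CM-T LOWER BOUND: a `k`-register tree on more than `N_k(C)` summands has `M ≥ 1 + (C+1)·u`. -/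
theorem treeM_lower_bound_of_regs {u : ℚ} (hu : 0 ≤ u) {t : SumTree} {k C : ℕ} (hk : regs t ≤ k)
    (hn : Nreg k C < (leaves t).length) : 1 + ((C : ℚ) + 1) * u ≤ treeM u t := by
  have h : ((C : ℚ) + 1) ≤ height t := by exact_mod_cast height_lower_bound hk hn
  nlinarith [one_add_height_mul_le_treeM hu t, mul_le_mul_of_nonneg_right h hu]

/-! ## Blocked streaming schemes are two-register trees -/

/-- Fold further sequential blocks onto `acc`: `((acc + B₁) + B₂) + ⋯`. -/
def streamTreeFrom (acc : SumTree) : List ℕ → SumTree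
  | [] => acc
  | b :: rest => streamTreeFrom (.node acc (seqTree b)) rest

/-- The one-precision streaming (blocked, FABsum-shaped) tree of block lengths `b₁, …, b_m`. -/
def streamTree : List ℕ → SumTree
  | [] => .leaf 0
  | b :: rest => streamTreeFrom (seqTree b) rest

/-- Recursive summation needs one register. -/
theorem regs_seqTree_le : ∀ n : ℕ, regs (seqTree n) ≤ 1
  | 0 => by simp [seqTree, regs]
  | 1 => by simp [seqTree, regs]
  | n + 2 => by simp only [seqTree, regs]; exact max_le (regs_seqTree_le (n + 1)) (by simp)

/-- Height of recursive summation: `n - 1`. -/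
theorem height_seqTree : ∀ n : ℕ, height (seqTree n) = n - 1
  | 0 => by simp [seqTree]
  | 1 => by simp [seqTree]
  | n + 2 => by simp only [seqTree, height_node, height_leaf, height_seqTree (n + 1)]; omega

/-- Folding sequential blocks onto a `≤ 2`-register accumulator stays within 2 registers. -/
theorem regs_streamTreeFrom_le : ∀ (rest : List ℕ) (acc : SumTree), regs acc ≤ 2 → regs (streamTreeFrom acc rest) ≤ 2
  | [], _, h => h
  | b :: rest, acc, h => regs_streamTreeFrom_le rest _
      (by simp only [regs]; exact max_le h (by have := regs_seqTree_le b; omega))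

/-- Blocked streaming summation needs two registers. -/
theorem regs_streamTree_le (blocks : List ℕ) : regs (streamTree blocks) ≤ 2 := by
  cases blocks with
  | nil => simp [streamTree, regs]
  | cons b rest => exact regs_streamTreeFrom_le rest _ (le_trans (regs_seqTree_le b) (by norm_num))

/-- Folding `j` equal blocks onto an accumulator of height `≥ b-1` raises the height by `j`. -/
theorem height_streamTreeFrom_replicate (b : ℕ) : ∀ (j : ℕ) (acc : SumTree), b - 1 ≤ height acc →
    height (streamTreeFrom acc (List.replicate j b)) = height acc + j
  | 0, acc, _ => by simp [streamTreeFrom]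
  | j + 1, acc, h => by
      rw [List.replicate_succ, streamTreeFrom, height_streamTreeFrom_replicate b j _
        (by simp only [height_node, height_seqTree]; omega)]
      simp only [height_node, height_seqTree]
      rw [max_eq_left h]; omega

/-- `m ≥ 1` equal blocks of length `b ≥ 1`: height `b + m - 2`. -/
theorem height_streamTree_replicate {b m : ℕ} (hb : 1 ≤ b) (hm : 1 ≤ m) :
    height (streamTree (List.replicate m b)) = b + m - 2 := by
  obtain ⟨m', rfl⟩ : ∃ m', m = m' + 1 := ⟨m - 1, by omega⟩
  rw [List.replicate_succ, streamTree, height_streamTreeFrom_replicate b m' _ (by rw [height_seqTree]),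
    height_seqTree]
  omega

/-- `n = 64`, two registers: `N_2(10) = 56 < 64 ≤ 67 = N_2(11)`, so `C*_2(64) = 11` (attained by a
staircase), whereas 8 equal blocks of 8 (the `b = √n` rule) have height `14`. -/
theorem example_n64 : Nreg 2 10 = 56 ∧ Nreg 2 11 = 67 ∧ (leaves (bt 2 11)).length = 67 ∧
    height (bt 2 11) = 11 ∧ regs (bt 2 11) = 2 ∧ height (streamTree (List.replicate 8 8)) = 14 := by
  refine ⟨by decide, by decide, by rw [length_leaves_bt]; decide, by decide, by decide, ?_⟩
  rw [height_streamTree_replicate (by norm_num) (by norm_num)]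

/-! ## Statement-level summary -/

/-- R4 (Opt, cost model CM-T, Theorem T6(d)): REGISTER–HEIGHT LAW.  For every summation tree `t`:
`#leaves ≤ N_{regs t}(height t)` with `N_k(C) = Σ_{i≤k} binom(C,i)`; conversely for all `k, C` and every
`1 ≤ n ≤ N_k(C)` there is a tree with `n` leaves, `≤ k` registers and height `≤ C` (the binomial
staircase `bt k C` has exactly `N_k(C)`); the tree polynomial satisfies `1 + height·u ≤ M_t(u) ≤
(1+u)^height` for `u = 2^-p`, so a `k`-register scheme on `n > N_k(C)` summands has `M ≥ 1 + (C+1)u`,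
i.e. worst-case relative under-estimation at least `1 - 1/(1 + C*_k(n)·u)` to this order, where
`C*_k(n) = min{C : N_k(C) ≥ n}`; `2·N_2(C) = C(C+1) + 2`; blocked streaming schemes use 2 registers and
`m` equal blocks of `b` have height `b + m - 2`. -/
def R4_RegisterHeightLaw : Prop :=
  (∀ t : SumTree, (leaves t).length ≤ Nreg (regs t) (height t)) ∧
  (∀ k C n : ℕ, 1 ≤ n → n ≤ Nreg k C → ∃ t : SumTree, (leaves t).length = n ∧ regs t ≤ k ∧ height t ≤ C) ∧
  (∀ k C : ℕ, (leaves (bt k C)).length = Nreg k C ∧ regs (bt k C) ≤ k ∧ height (bt k C) ≤ C) ∧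
  (∀ (p : ℕ) (t : SumTree), 1 + (height t : ℚ) * unitRoundoff p ≤ treeM (unitRoundoff p) t ∧
      treeM (unitRoundoff p) t ≤ (1 + unitRoundoff p) ^ height t) ∧
  (∀ (p k C : ℕ) (t : SumTree), regs t ≤ k → Nreg k C < (leaves t).length →
      1 + ((C : ℚ) + 1) * unitRoundoff p ≤ treeM (unitRoundoff p) t) ∧
  (∀ C : ℕ, 2 * Nreg 2 C = C * (C + 1) + 2) ∧
  (∀ blocks : List ℕ, regs (streamTree blocks) ≤ 2) ∧
  (∀ b m : ℕ, 1 ≤ b → 1 ≤ m → height (streamTree (List.replicate m b)) = b + m - 2)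

/-- `R4_RegisterHeightLaw` holds. -/
theorem R4_RegisterHeightLaw_holds : R4_RegisterHeightLaw :=
  ⟨length_leaves_le_Nreg, exists_tree_of_le_Nreg,
   fun k C => ⟨length_leaves_bt k C, regs_bt_le k C, height_bt_le k C⟩,
   fun p t => ⟨one_add_height_mul_le_treeM (unitRoundoff_nonneg p) t, treeM_le_pow_height (unitRoundoff_nonneg p) t⟩,
   fun p _ _ _ hk hn => treeM_lower_bound_of_regs (unitRoundoff_nonneg p) hk hn,
   two_mul_Nreg_two, regs_streamTree_le, fun _ _ hb hm => height_streamTree_replicate hb hm⟩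

end Summit.Ventures.CertifiedArithmetic.LowPrec.Opt
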